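import Literature.Probability.MarkovChains.PeskunOrdering
import Literature.Probability.MarkovChains.MetropolisHastings
import HarnessLib

/-!
# The mixed-parity witness in Peskun's vocabulary: the Metropolis–Hastings kernel of the SYMMETRISED independence proposal has the LARGER Kemeny–Snell asymptotic variance (`14/9` against `10/9`)

HONEST FRAMING: exact (Metropolis-corrected) sampling algorithms for lattice gauge theory;
figures of merit are autocorrelation/cost numbers at stated couplings and volumes; no
continuum-physics claim.  (SCALAR calibration rung S0-A: not a gauge result.)

Venture `LatticeQCDFlow` (cell pub-lqcd), topic `Exactness`; FANOUT row 2 (`s0-phi4`).  NEW WORK of the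
cell, companion of `FlowSamplerSymmetrisationMixedParity` (same three-state witness, there in the
flow-arm vocabulary `imhOp`/`tauInt`): here in the tree's FINITE-STATE vocabulary of
`Literature.Probability.MarkovChains.{MetropolisHastings, PeskunOrdering}` — `mhKernel T π` the
Metropolis–Hastings matrix of a proposal matrix `T`, `fundamentalMatrix π P = (I − (P − A))⁻¹`,
`asympVar f π P = f(2BZ − B − BA)fᵀ` (Peskun 1973 eq. (4), Kemeny–Snell's closed form).  Data: uniform
`π ≡ 1/3` on `Fin 3`, independence proposals `T(x,y) = q̃(y)` with `q̃ = (1/20, 3/5, 7/20)` and its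
`(0 2)`-symmetrisation `T_s(x,y) = q̃ₛ(y)`, `q̃ₛ = (1/5, 3/5, 1/5)`; observable `f = (0, −1, 1)`.
Both kernels have `f` as an EIGENVECTOR (`P f = ¼ f`, `P_s f = ⅖ f`), hence `Z f = f/(1 − λ)` and
`v(f) = ‖f‖²_π (1 + λ)/(1 − λ)`: **`v(f, π, P) = 10/9 < 14/9 = v(f, π, P_s)`** (and `τ_int = v/(2‖f‖²_π)`
is `5/6` against `7/6`, matching the flow-arm file).  Neither kernel dominates the other off the
diagonal (`P_s` moves more mass between `0 ↔ 1`, `0 ↔ 2` but less between `1 ↔ 2`), so Peskun's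
theorem (`asympVar_le_of_offDiag_le`) is silent here, consistently.  Nothing is cited; the Literature
files carry their own citations.

## What is proved (namespace `MixedParityWitness`)

* `mhKernel_qW_entry`, `mhKernel_qWs_entry` — the two `3 × 3` kernels entrywise;
* `mhKernel_qW_mulVec_fW` (`P f = ¼ f`), `mhKernel_qWs_mulVec_fW` (`P_s f = ⅖ f`);
* `fundamentalMatrix_qW_mulVec_fW` (`Z f = (4/3) f`), `fundamentalMatrix_qWs_mulVec_fW` (`Z_s f = (5/3) f`);
* **`asympVar_qW`, `asympVar_qWs`** — `10/9` and `14/9`; **`peskun_asympVar_lt_symmetrised`** — the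
  strict reversal, with `P_s ≰ P` and `P ≰ P_s` off the diagonal (`not_offDiag_le`, `not_offDiag_ge`).
-/

namespace Summit.Ventures.LatticeQCDFlow.Exactness

namespace MixedParityWitness

open Finset Matrix Literature.Probability.MarkovChains

/-! ## §1 The two kernels -/

/-- Entries of `P = mhKernel (x,y ↦ q̃ y) π`, `π ≡ 1/3`, `q̃ = (1/20, 3/5, 7/20)`:
`P = [[9/10, 1/20, 1/20], [1/20, 3/5, 7/20], [1/20, 7/20, 3/5]]`. -/
theorem mhKernel_qW_entry :
    (mhKernel (fun _ y : Fin 3 => (![1 / 20, 3 / 5, 7 / 20] : Fin 3 → ℝ) y) (fun _ : Fin 3 => (1 / 3 : ℝ)))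
      = !![9 / 10, 1 / 20, 1 / 20; 1 / 20, 3 / 5, 7 / 20; 1 / 20, 7 / 20, 3 / 5] := by
  funext x y
  fin_cases x <;> fin_cases y <;>
    simp [mhKernel, mhRate, Finset.sum_erase_eq_sub, Fin.sum_univ_three] <;> norm_num [min_def]

/-- Entries of `P_s = mhKernel (x,y ↦ q̃ₛ y) π`, `q̃ₛ = (1/5, 3/5, 1/5)`:
`P_s = [[3/5, 1/5, 1/5], [1/5, 3/5, 1/5], [1/5, 1/5, 3/5]]`. -/
theorem mhKernel_qWs_entry :
    (mhKernel (fun _ y : Fin 3 => (![1 / 5, 3 / 5, 1 / 5] : Fin 3 → ℝ) y) (fun _ : Fin 3 => (1 / 3 : ℝ)))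
      = !![3 / 5, 1 / 5, 1 / 5; 1 / 5, 3 / 5, 1 / 5; 1 / 5, 1 / 5, 3 / 5] := by
  funext x y
  fin_cases x <;> fin_cases y <;>
    simp [mhKernel, mhRate, Finset.sum_erase_eq_sub, Fin.sum_univ_three] <;> norm_num [min_def]

/-- `q̃ₛ` IS the `(0 2)`-symmetrisation of `q̃`. -/
theorem qWs_eq_symmetrised :
    (![1 / 5, 3 / 5, 1 / 5] : Fin 3 → ℝ)
      = fun y => ((![1 / 20, 3 / 5, 7 / 20] : Fin 3 → ℝ) y
          + (![1 / 20, 3 / 5, 7 / 20] : Fin 3 → ℝ) (Equiv.swap (0 : Fin 3) 2 y)) / 2 := by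
  funext y
  fin_cases y <;> simp [Equiv.swap_apply_def] <;> norm_num

/-- **`P f = ¼ f`** for `f = (0, −1, 1)`. -/
theorem mhKernel_qW_mulVec_fW :
    (mhKernel (fun _ y : Fin 3 => (![1 / 20, 3 / 5, 7 / 20] : Fin 3 → ℝ) y) (fun _ : Fin 3 => (1 / 3 : ℝ)))
        *ᵥ (![0, -1, 1] : Fin 3 → ℝ) = (1 / 4 : ℝ) • (![0, -1, 1] : Fin 3 → ℝ) := by
  rw [mhKernel_qW_entry]
  funext x
  fin_cases x <;> simp [Matrix.mulVec, dotProduct, Fin.sum_univ_three] <;> norm_num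

/-- **`P_s f = ⅖ f`**. -/
theorem mhKernel_qWs_mulVec_fW :
    (mhKernel (fun _ y : Fin 3 => (![1 / 5, 3 / 5, 1 / 5] : Fin 3 → ℝ) y) (fun _ : Fin 3 => (1 / 3 : ℝ)))
        *ᵥ (![0, -1, 1] : Fin 3 → ℝ) = (2 / 5 : ℝ) • (![0, -1, 1] : Fin 3 → ℝ) := by
  rw [mhKernel_qWs_entry]
  funext x
  fin_cases x <;> simp [Matrix.mulVec, dotProduct, Fin.sum_univ_three] <;> norm_num

/-! ## §2 Fundamental matrices and asymptotic variances -/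

/-- Bookkeeping for a row-stochastic kernel with an eigenvector: if `P` is a Metropolis–Hastings kernel
for the positive probability vector `π`, irreducible, and `P f = λ f` with `Σ π f = 0`, `λ ≠ 1`, then
`Z f = (1 − λ)⁻¹ f` and `v(f, π, P) = (2/(1 − λ) − 1)·⟨f, f⟩_π`. -/
theorem asympVar_of_eigen {X : Type*} [Fintype X] [DecidableEq X] {π : X → ℝ} (hπ : ∀ x, 0 < π x)
    (hπ1 : ∑ x, π x = 1) (T : X → X → ℝ) (hT : ∀ x y, 0 ≤ T x y) (hTrow : ∀ x, ∑ y, T x y ≤ 1)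
    (hirr : Literature.Probability.MarkovChains.IsIrreducible (mhKernel T π : Matrix X X ℝ)) {f : X → ℝ} (hf : ∑ y, π y * f y = 0) {lam : ℝ}
    (hlam : lam ≠ 1) (heig : (mhKernel T π) *ᵥ f = lam • f) :
    fundamentalMatrix π (mhKernel T π) *ᵥ f = (1 - lam)⁻¹ • f ∧
    asympVar f π (mhKernel T π) = (2 / (1 - lam) - 1) * piInner π f f := by
  set P : Matrix X X ℝ := mhKernel T π with hPdef
  have hP : IsRowStochastic P := ⟨mhKernel_nonneg hT hTrow hπ, mhKernel_sum_eq_one T π⟩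
  have hst : IsStationary π P := mhKernel_isStationary hπ T
  have hK := isUnit_fundamentalInv hπ1 hP hst hirr
  have h1l : (1 - lam) ≠ 0 := sub_ne_zero.2 (Ne.symm hlam)
  -- `(I − (P − A)) f = (1 − λ) f`
  have hA : (1 - (P - limitMatrix π)) *ᵥ f = (1 - lam) • f := by
    have hlim : limitMatrix π *ᵥ f = 0 := by
      funext x
      simp only [limitMatrix, Matrix.mulVec, dotProduct, Matrix.of_apply, Pi.zero_apply]
      exact hf
    rw [Matrix.sub_mulVec, Matrix.sub_mulVec, Matrix.one_mulVec, heig, hlim, sub_zero, sub_smul,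
      one_smul]
  have hZ : fundamentalMatrix π P *ᵥ f = (1 - lam)⁻¹ • f := by
    have h := fundamentalMatrix_mul_fundamentalInv (π := π) (P := P) hK
    have h2 : fundamentalMatrix π P *ᵥ ((1 - (P - limitMatrix π)) *ᵥ f) = f := by
      rw [Matrix.mulVec_mulVec, h, Matrix.one_mulVec]
    rw [hA, Matrix.mulVec_smul] at h2
    calc fundamentalMatrix π P *ᵥ f
        = (1 - lam)⁻¹ • ((1 - lam) • (fundamentalMatrix π P *ᵥ f)) := by
          rw [smul_smul, inv_mul_cancel₀ h1l, one_smul]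
      _ = (1 - lam)⁻¹ • f := by rw [h2]
  refine ⟨hZ, ?_⟩
  have hc : centred π f = f := by
    funext x
    simp only [centred, hf, sub_zero]
  rw [asympVar_eq_centred hπ1 hP hst hK, hc, hZ]
  unfold piInner
  simp only [Pi.smul_apply, smul_eq_mul]
  have e : ∑ x, π x * (f x * ((1 - lam)⁻¹ * f x)) = (1 - lam)⁻¹ * ∑ x, π x * (f x * f x) := by
    rw [Finset.mul_sum]
    exact Finset.sum_congr rfl fun x _ => by ring
  rw [e, div_eq_mul_inv]
  ring

/-- `P` is irreducible (every entry positive). -/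
theorem mhKernel_qW_irreducible :
    Literature.Probability.MarkovChains.IsIrreducible
      (mhKernel (fun _ y : Fin 3 => (![1 / 20, 3 / 5, 7 / 20] : Fin 3 → ℝ) y)
        (fun _ : Fin 3 => (1 / 3 : ℝ)) : Matrix (Fin 3) (Fin 3) ℝ) := by
  intro x y
  refine ⟨1, ?_⟩
  rw [pow_one, mhKernel_qW_entry]
  fin_cases x <;> fin_cases y <;> simp

/-- `P_s` is irreducible (every entry positive). -/
theorem mhKernel_qWs_irreducible :
    Literature.Probability.MarkovChains.IsIrreducible
      (mhKernel (fun _ y : Fin 3 => (![1 / 5, 3 / 5, 1 / 5] : Fin 3 → ℝ) y)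
        (fun _ : Fin 3 => (1 / 3 : ℝ)) : Matrix (Fin 3) (Fin 3) ℝ) := by
  intro x y
  refine ⟨1, ?_⟩
  rw [pow_one, mhKernel_qWs_entry]
  fin_cases x <;> fin_cases y <;> simp

/-- `f = (0, −1, 1)` is centred for the uniform `π` and `⟨f, f⟩_π = 2/3`. -/
theorem fW_centred_sqNorm :
    (∑ y, (fun _ : Fin 3 => (1 / 3 : ℝ)) y * (![0, -1, 1] : Fin 3 → ℝ) y) = 0 ∧
    piInner (fun _ : Fin 3 => (1 / 3 : ℝ)) (![0, -1, 1] : Fin 3 → ℝ) (![0, -1, 1] : Fin 3 → ℝ) = 2 / 3 := by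
  unfold piInner
  simp [Fin.sum_univ_three]
  norm_num

/-- **`v(f, π, P) = 10/9`** (`Z f = (4/3) f`). -/
theorem asympVar_qW :
    fundamentalMatrix (fun _ : Fin 3 => (1 / 3 : ℝ))
        (mhKernel (fun _ y : Fin 3 => (![1 / 20, 3 / 5, 7 / 20] : Fin 3 → ℝ) y) (fun _ : Fin 3 => (1 / 3 : ℝ)))
        *ᵥ (![0, -1, 1] : Fin 3 → ℝ) = (4 / 3 : ℝ) • (![0, -1, 1] : Fin 3 → ℝ) ∧
    asympVar (![0, -1, 1] : Fin 3 → ℝ) (fun _ : Fin 3 => (1 / 3 : ℝ))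
        (mhKernel (fun _ y : Fin 3 => (![1 / 20, 3 / 5, 7 / 20] : Fin 3 → ℝ) y) (fun _ : Fin 3 => (1 / 3 : ℝ)))
      = 10 / 9 := by
  obtain ⟨h0, h2⟩ := fW_centred_sqNorm
  obtain ⟨hZ, hv⟩ := asympVar_of_eigen (π := fun _ : Fin 3 => (1 / 3 : ℝ)) (fun _ => by norm_num)
    (by simp) (fun _ y : Fin 3 => (![1 / 20, 3 / 5, 7 / 20] : Fin 3 → ℝ) y)
    (fun _ y => by fin_cases y <;> norm_num) (fun _ => by simp [Fin.sum_univ_three]; norm_num)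
    mhKernel_qW_irreducible h0
    (lam := 1 / 4) (by norm_num) mhKernel_qW_mulVec_fW
  refine ⟨by rw [hZ]; norm_num, ?_⟩
  rw [hv, h2]
  norm_num

/-- **`v(f, π, P_s) = 14/9`** (`Z_s f = (5/3) f`). -/
theorem asympVar_qWs :
    fundamentalMatrix (fun _ : Fin 3 => (1 / 3 : ℝ))
        (mhKernel (fun _ y : Fin 3 => (![1 / 5, 3 / 5, 1 / 5] : Fin 3 → ℝ) y) (fun _ : Fin 3 => (1 / 3 : ℝ)))
        *ᵥ (![0, -1, 1] : Fin 3 → ℝ) = (5 / 3 : ℝ) • (![0, -1, 1] : Fin 3 → ℝ) ∧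
    asympVar (![0, -1, 1] : Fin 3 → ℝ) (fun _ : Fin 3 => (1 / 3 : ℝ))
        (mhKernel (fun _ y : Fin 3 => (![1 / 5, 3 / 5, 1 / 5] : Fin 3 → ℝ) y) (fun _ : Fin 3 => (1 / 3 : ℝ)))
      = 14 / 9 := by
  obtain ⟨h0, h2⟩ := fW_centred_sqNorm
  obtain ⟨hZ, hv⟩ := asympVar_of_eigen (π := fun _ : Fin 3 => (1 / 3 : ℝ)) (fun _ => by norm_num)
    (by simp) (fun _ y : Fin 3 => (![1 / 5, 3 / 5, 1 / 5] : Fin 3 → ℝ) y)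
    (fun _ y => by fin_cases y <;> norm_num) (fun _ => by simp [Fin.sum_univ_three]; norm_num)
    mhKernel_qWs_irreducible h0
    (lam := 2 / 5) (by norm_num) mhKernel_qWs_mulVec_fW
  refine ⟨by rw [hZ]; norm_num, ?_⟩
  rw [hv, h2]
  norm_num

/-! ## §3 The reversal, and why Peskun's theorem is silent -/

/-- **THE SYMMETRISED PROPOSAL HAS THE LARGER ASYMPTOTIC VARIANCE FOR `f`**:
`v(f, π, P) = 10/9 < 14/9 = v(f, π, P_s)`. -/
theorem peskun_asympVar_lt_symmetrised :
    asympVar (![0, -1, 1] : Fin 3 → ℝ) (fun _ : Fin 3 => (1 / 3 : ℝ))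
        (mhKernel (fun _ y : Fin 3 => (![1 / 20, 3 / 5, 7 / 20] : Fin 3 → ℝ) y) (fun _ : Fin 3 => (1 / 3 : ℝ)))
      < asympVar (![0, -1, 1] : Fin 3 → ℝ) (fun _ : Fin 3 => (1 / 3 : ℝ))
        (mhKernel (fun _ y : Fin 3 => (![1 / 5, 3 / 5, 1 / 5] : Fin 3 → ℝ) y) (fun _ : Fin 3 => (1 / 3 : ℝ))) := by
  rw [asympVar_qW.2, asympVar_qWs.2]
  norm_num

/-- `P_s` does NOT dominate `P` off the diagonal (entry `(1,2)`: `1/5 < 7/20`). -/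
theorem not_offDiag_le :
    ¬ ∀ x y : Fin 3, x ≠ y →
      mhKernel (fun _ y : Fin 3 => (![1 / 20, 3 / 5, 7 / 20] : Fin 3 → ℝ) y) (fun _ : Fin 3 => (1 / 3 : ℝ)) x y
        ≤ mhKernel (fun _ y : Fin 3 => (![1 / 5, 3 / 5, 1 / 5] : Fin 3 → ℝ) y) (fun _ : Fin 3 => (1 / 3 : ℝ)) x y := by
  intro h
  have h12 := h 1 2 (by decide)
  rw [mhKernel_qW_entry, mhKernel_qWs_entry] at h12
  simp at h12
  norm_num at h12

/-- `P` does NOT dominate `P_s` off the diagonal either (entry `(0,1)`: `1/20 < 1/5`). -/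
theorem not_offDiag_ge :
    ¬ ∀ x y : Fin 3, x ≠ y →
      mhKernel (fun _ y : Fin 3 => (![1 / 5, 3 / 5, 1 / 5] : Fin 3 → ℝ) y) (fun _ : Fin 3 => (1 / 3 : ℝ)) x y
        ≤ mhKernel (fun _ y : Fin 3 => (![1 / 20, 3 / 5, 7 / 20] : Fin 3 → ℝ) y) (fun _ : Fin 3 => (1 / 3 : ℝ)) x y := by
  intro h
  have h01 := h 0 1 (by decide)
  rw [mhKernel_qW_entry, mhKernel_qWs_entry] at h01
  simp at h01
  norm_num at h01

end MixedParityWitness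

end Summit.Ventures.LatticeQCDFlow.Exactness
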